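import Mathlib
import HarnessLib
import Literature.NumberTheory.LFunctions.VanDerCorputZeta

/-!
# Van der Corput's `k`-th derivative tests with Titchmarsh's exponents (`k = 2, 3, 4`) and the
# bound `∑_{M/2 ≤ m ≤ M} m^{it} ≪ M^{5/7} t^{1/14} + M^{29/28} t^{-1/14}`

Topic `Literature/NumberTheory/LFunctions`. Everything in this file is PROVED (no `sorry`, no
named facts). It continues `Literature/NumberTheory/LFunctions/VanDerCorputZeta.lean`
(namespace `Literature.VdC`: `e`, `DerivFamily`, `secondDerivTest`, `vanDerCorput_e`, `phaseD`, …),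
whose `k`-th derivative test `Literature.NumberTheory.LFunctions.VdC.kth_deriv_test` only asserts *some* exponents
`0 < α_k, β_k ≤ 1`. Here the Weyl–van der Corput induction is redone with the bookkeeping of
Titchmarsh, Thm 5.13, so that the exponents come out as printed there:
`‖∑_{a<n≤b} e(f(n))‖ ≤ C_k h ((b-a) λ^{1/(2K-2)} + (b-a)^{1-2/K} λ^{-1/(2K-2)})`, `K = 2^{k-1}`,
whenever `λ ≤ f^{(k)} ≤ hλ` on `[a, b]` (we only record `k = 2, 3, 4`, with the weak absolute
constants `12`, `96`, `768`; Titchmarsh's constants are independent of `k` and carry `h^{2/K}`).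

Main results:
* `Literature.NumberTheory.LFunctions.VdC.kboundSharp_step` — the induction step `(C, α, β) ↦ (8C, α/(2(1+α)), β/2)`
  (Titchmarsh §5.13; cf. Graham–Kolesnik Thm 2.8, whose secondary terms are smaller).
* `Literature.NumberTheory.LFunctions.VdC.thirdDerivTest` — `λ ≤ f''' ≤ hλ` ⟹
  `‖∑ e(f(n))‖ ≤ 96 h ((b-a) λ^{1/6} + (b-a)^{1/2} λ^{-1/6})` (Titchmarsh Thm 5.11;
  cf. Graham–Kolesnik Thm 2.6).
* `Literature.NumberTheory.LFunctions.VdC.fourthDerivTest`, `Literature.NumberTheory.LFunctions.VdC.fourthDerivTest_signed` — `λ ≤ ±f'''' ≤ hλ` ⟹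
  `‖∑ e(f(n))‖ ≤ 768 h ((b-a) λ^{1/14} + (b-a)^{3/4} λ^{-1/14})` (Titchmarsh Thm 5.13, `k = 4`).
* `Literature.NumberTheory.LFunctions.VdC.norm_sum_Icc_cpow_mul_I_le` — **there is an absolute `C` with
  `‖∑_{M/2 ≤ m ≤ M} m^{it}‖ ≤ C (M^{5/7} t^{1/14} + M^{29/28} t^{-1/14})` for all real `t ≥ 1`,
  `M ≥ 1`.** This is the estimate of the exponent pair `(1/14, 11/14) = A²B(0, 1)` for the phase
  `f(y) = (t/2π) log y` (`|f''''| ≍ t/M⁴` on `[M/2, M]`; Titchmarsh §5.20, Graham–Kolesnik §3.1),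
  obtained from the fourth derivative test. It is used in
  `Literature/NumberTheory/LFunctions/ZetaSubconvexity.lean` in place of the exponent pair
  `(1/9, 13/18)` of Bourgain 2017, eq. (4.2): `M^{5/7} t^{1/14} ≤ M^{1/2} t^{13/84}` exactly when
  `M ≤ t^{7/18}`, and `7/18 > 12/31`.

## References
* E. C. Titchmarsh, *The Theory of the Riemann Zeta-Function*, 2nd ed. (rev. D. R. Heath-Brown),
  Oxford 1986, Thms 5.9, 5.11, 5.13, §5.20.
* S. W. Graham, G. Kolesnik, *Van der Corput's Method of Exponential Sums*, LMS Lecture Note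
  Series 126, Cambridge 1991, Thm 2.2, Lemma 2.5, (2.3.4), Thm 2.6, Thm 2.8, §3.1.

## Design notes
* Statements use the conventions of `VanDerCorputZeta.lean`: sums over `Finset.Ioc a b`,
  `a b : ℤ`, phases through derivative families `D : ℕ → ℝ → ℝ` (`Literature.VdC.DerivFamily D a b k`),
  `D 0 = f`, `D j = f^{(j)}`.
* The hypotheses `λ ≤ D k ≤ hλ` are one-sided (positive `k`-th derivative); the sign wrapper
  `fourthDerivTest_signed` conjugates the sum. Constants are explicit but not optimized.
* No result is stated stronger than what is proved; `[cite: …]` tags on proved theorems point to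
  the corresponding (sharper in the constants) statements in print.
-/

noncomputable section

open Finset Real

namespace Literature.NumberTheory.LFunctions
namespace VdC

/-- Base case `k = 2` (second derivative test, Titchmarsh Thm 5.9 / Graham–Kolesnik Thm 2.2):
`C = 12 h`, `α = 1/2`, `β = 1`. [cite: Titchmarsh1986, Thm 5.9] -/
theorem kboundSharp_two {h : ℝ} (hh : 1 ≤ h) :
    ∀ lam : ℝ, 0 < lam → ∀ a b : ℤ, a < b → ∀ D : ℕ → ℝ → ℝ, DerivFamily D a b 2 →
      (∀ y ∈ Set.Icc (a : ℝ) b, lam ≤ D 2 y ∧ D 2 y ≤ h * lam) →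
        ‖∑ n ∈ Finset.Ioc a b, e (D 0 n)‖
          ≤ (12 * h) * (((b : ℝ) - a) * lam ^ (1 / 2 : ℝ)
            + ((b : ℝ) - a) ^ (1 - (1 : ℝ)) * lam ^ (-(1 / 2 : ℝ))) := by
  intro lam hlam a b hab D hD hbound
  have h0 := hD 0 (by norm_num)
  have h1 := hD 1 (by norm_num)
  have hmain := secondDerivTest hab.le hlam hh h0 h1 hbound
  refine hmain.trans ?_
  rw [Real.sqrt_eq_rpow, sub_self, Real.rpow_zero, one_mul, Real.rpow_neg hlam.le, ← one_div]
  set r : ℝ := lam ^ (1 / 2 : ℝ) with hr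
  have hr0 : 0 < r := Real.rpow_pos_of_pos hlam _
  have h2 : 1 / r ≤ h * (1 / r) := le_mul_of_one_le_left (by positivity) hh
  calc 12 * (h * ((b : ℝ) - a) * r + 1 / r)
      ≤ 12 * (h * ((b : ℝ) - a) * r + h * (1 / r)) := by linarith
    _ = 12 * h * (((b : ℝ) - a) * r + 1 / r) := by ring

/-- `(1 - γ) (x + 1)^{-γ} ≤ (x + 1)^{1-γ} - x^{1-γ}` for `x ≥ 0`, `0 < γ < 1` (weighted AM–GM:
`x^{1-γ} (x+1)^γ ≤ (1-γ) x + γ (x+1) = x + γ`). [folklore] -/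
theorem rpow_neg_le_sub_rpow {x γ : ℝ} (hx : 0 ≤ x) (hγ : 0 < γ) (hγ1 : γ < 1) :
    (1 - γ) * (x + 1) ^ (-γ) ≤ (x + 1) ^ (1 - γ) - x ^ (1 - γ) := by
  have hx1 : 0 < x + 1 := by linarith
  have hamgm : x ^ (1 - γ) * (x + 1) ^ γ ≤ (1 - γ) * x + γ * (x + 1) :=
    Real.geom_mean_le_arith_mean2_weighted (by linarith) hγ.le hx hx1.le (by ring)
  have hpow : 0 < (x + 1) ^ (-γ) := Real.rpow_pos_of_pos hx1 _
  -- multiply by `(x+1)^{-γ}`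
  have h1 : x ^ (1 - γ) = x ^ (1 - γ) * (x + 1) ^ γ * (x + 1) ^ (-γ) := by
    rw [mul_assoc, ← Real.rpow_add hx1, add_neg_cancel, Real.rpow_zero, mul_one]
  have h2 : (x + 1) ^ (1 - γ) = (x + 1) * (x + 1) ^ (-γ) := by
    rw [sub_eq_add_neg, Real.rpow_add hx1, Real.rpow_one]
  rw [h1, h2]
  have h3 : x ^ (1 - γ) * (x + 1) ^ γ * (x + 1) ^ (-γ) ≤ ((1 - γ) * x + γ * (x + 1)) * (x + 1) ^ (-γ) :=
    mul_le_mul_of_nonneg_right hamgm hpow.le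
  nlinarith [h3, hpow]

/-- `∑_{i < n} (i + 1)^{-γ} ≤ n^{1-γ}/(1-γ)` for `0 < γ < 1`. [folklore] -/
theorem sum_range_succ_rpow_neg_le (n : ℕ) {γ : ℝ} (hγ : 0 < γ) (hγ1 : γ < 1) :
    ∑ i ∈ Finset.range n, ((i : ℝ) + 1) ^ (-γ) ≤ (n : ℝ) ^ (1 - γ) / (1 - γ) := by
  have hγ' : 0 < 1 - γ := by linarith
  rw [le_div_iff₀ hγ', Finset.sum_mul]
  have key : ∀ i ∈ Finset.range n,
      ((i : ℝ) + 1) ^ (-γ) * (1 - γ) ≤ ((i : ℝ) + 1) ^ (1 - γ) - (i : ℝ) ^ (1 - γ) := by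
    intro i _
    rw [mul_comm]
    exact rpow_neg_le_sub_rpow (Nat.cast_nonneg i) hγ hγ1
  refine (Finset.sum_le_sum key).trans ?_
  have htel := Finset.sum_range_sub (fun i : ℕ => (i : ℝ) ^ (1 - γ)) n
  simp only [Nat.cast_add, Nat.cast_one, Nat.cast_zero] at htel
  rw [htel, Real.zero_rpow hγ'.ne', sub_zero]

/-- `∑_{1 ≤ d < H} d^{-γ} ≤ H^{1-γ}/(1-γ)` (`d` ranging over integers), `0 < γ < 1`. [folklore] -/
theorem sum_Ico_int_rpow_neg_le (H : ℕ) {γ : ℝ} (hγ : 0 < γ) (hγ1 : γ < 1) :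
    ∑ d ∈ Finset.Ico (1 : ℤ) H, ((d : ℤ) : ℝ) ^ (-γ) ≤ (H : ℝ) ^ (1 - γ) / (1 - γ) := by
  have hγ' : 0 < 1 - γ := by linarith
  rcases Nat.eq_zero_or_pos H with rfl | hH
  · simp [Real.zero_rpow hγ'.ne']
  rw [Int.Ico_eq_finset_map, Finset.sum_map]
  have hn : ((H : ℤ) - 1).toNat = H - 1 := by omega
  rw [hn]
  have hterm : ∀ i ∈ Finset.range (H - 1),
      ((((Nat.castEmbedding.trans (addLeftEmbedding (1 : ℤ))) i : ℤ) : ℝ)) ^ (-γ)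
        = ((i : ℝ) + 1) ^ (-γ) := by
    intro i _
    congr 1
    simp only [Function.Embedding.trans_apply, Nat.castEmbedding_apply, addLeftEmbedding_apply]
    push_cast
    ring
  rw [Finset.sum_congr rfl hterm]
  refine (sum_range_succ_rpow_neg_le (H - 1) hγ hγ1).trans ?_
  apply div_le_div_of_nonneg_right _ hγ'.le
  exact Real.rpow_le_rpow (Nat.cast_nonneg _) (by exact_mod_cast Nat.sub_le H 1) hγ'.le


set_option maxHeartbeats 400000 in
/-- The real-variable bookkeeping of the sharp induction step: with `θ = α/(1+α)`,
`H₀ = λ^{-θ}`, `H = ⌊H₀⌋`, the Weyl–van der Corput inequality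
`s² ≤ 2L²/H + (4L/H) T`, `T = ∑_{d<H} |S_d|`, and
`T ≤ C H L (Hλ)^α + 2 C L^{1-β} λ^{-α} H^{1-α}` give `s ≤ 8C (L λ^{θ/2} + L^{1-β/2} λ^{-θ/2})`.
[folklore] -/
theorem stepSharp_algebra {C α β lam L H₀ s T : ℝ} {H : ℕ} (hC : 1 ≤ C) (hα : 0 < α)
    (hα1 : α ≤ 1) (hlam : 0 < lam) (hL : 1 ≤ L)
    (hH₀ : H₀ = lam ^ (-(α / (1 + α)))) (hH : 1 ≤ H) (hHH₀ : (H : ℝ) ≤ H₀) (hH₀H : H₀ < 2 * H)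
    (hvdc : s ^ 2 ≤ 2 * L ^ 2 / H + 4 * L / H * T)
    (hTb : T ≤ C * ((H : ℝ) * (L * ((H : ℝ) * lam) ^ α))
      + C * (L ^ (1 - β) * lam ^ (-α)) * (2 * (H : ℝ) ^ (1 - α))) :
    s ≤ 8 * C * (L * lam ^ (α / (2 * (1 + α))) + L ^ (1 - β / 2) * lam ^ (-(α / (2 * (1 + α))))) := by
  set θ : ℝ := α / (1 + α) with hθ
  have hα0 : 0 < 1 + α := by linarith
  have hθpos : 0 < θ := div_pos hα hα0
  have hθ1 : 1 - θ = 1 / (1 + α) := by rw [hθ]; field_simp; ring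
  have hθα : (1 - θ) * α = θ := by rw [hθ1, hθ]; field_simp
  have hHpos : (0 : ℝ) < H := by exact_mod_cast hH
  have hL0 : 0 < L := by linarith
  have hlamθ : 0 < lam ^ θ := Real.rpow_pos_of_pos hlam θ
  have hlamθ' : 0 < lam ^ (-θ) := Real.rpow_pos_of_pos hlam _
  have hH₀lam : H₀ * lam ^ θ = 1 := by
    rw [hH₀, Real.rpow_neg hlam.le, inv_mul_cancel₀ hlamθ.ne']
  have hH₀pos : 0 < H₀ := by rw [hH₀]; positivity
  -- (a) `1/H ≤ 2 lam^θ`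
  have ha : 1 / (H : ℝ) ≤ 2 * lam ^ θ := by
    rw [div_le_iff₀ hHpos]
    nlinarith [hH₀lam, hH₀H, hlamθ]
  -- (b) `(H lam)^α ≤ lam^θ`
  have hH₀lam' : H₀ * lam = lam ^ (1 - θ) := by
    rw [hH₀, Real.rpow_sub hlam, Real.rpow_one, Real.rpow_neg hlam.le]
    field_simp
  have hb : ((H : ℝ) * lam) ^ α ≤ lam ^ θ := by
    have h1 : (H : ℝ) * lam ≤ H₀ * lam := mul_le_mul_of_nonneg_right hHH₀ hlam.le
    calc ((H : ℝ) * lam) ^ α ≤ (H₀ * lam) ^ α := Real.rpow_le_rpow (by positivity) h1 hα.le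
      _ = lam ^ θ := by rw [hH₀lam', ← Real.rpow_mul hlam.le, hθα]
  -- (c) `lam^{-α} H^{1-α} / H ≤ 2 lam^{-θ}`
  have hc : lam ^ (-α) * (H : ℝ) ^ (1 - α) / H ≤ 2 * lam ^ (-θ) := by
    have e1 : lam ^ (-α) * (H : ℝ) ^ (1 - α) / H = ((H : ℝ) * lam) ^ (-α) := by
      rw [Real.rpow_sub hHpos, Real.rpow_one, Real.mul_rpow hHpos.le hlam.le,
        Real.rpow_neg hHpos.le]
      field_simp
    rw [e1]
    have h1 : H₀ * lam / 2 ≤ (H : ℝ) * lam := by nlinarith [hH₀H, hlam]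
    have hpos : 0 < H₀ * lam / 2 := by positivity
    have h2α : (2 : ℝ) ^ α ≤ 2 := by
      calc (2 : ℝ) ^ α ≤ (2 : ℝ) ^ (1 : ℝ) :=
            Real.rpow_le_rpow_of_exponent_le (by norm_num) hα1
        _ = 2 := Real.rpow_one 2
    calc ((H : ℝ) * lam) ^ (-α) ≤ (H₀ * lam / 2) ^ (-α) :=
          Real.rpow_le_rpow_of_nonpos hpos h1 (by linarith)
      _ = (lam ^ (1 - θ)) ^ (-α) * (2 : ℝ) ^ α := by
          rw [hH₀lam', Real.div_rpow (by positivity) (by norm_num),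
            Real.rpow_neg (by norm_num : (0 : ℝ) ≤ 2), div_inv_eq_mul]
      _ = lam ^ (-θ) * (2 : ℝ) ^ α := by
          rw [← Real.rpow_mul hlam.le]
          congr 2
          rw [mul_neg, hθα]
      _ ≤ lam ^ (-θ) * 2 := mul_le_mul_of_nonneg_left h2α hlamθ'.le
      _ = 2 * lam ^ (-θ) := by ring
  -- combine: `s² ≤ 8 C L² lam^θ + 16 C L^{2-β} lam^{-θ}`
  set A : ℝ := L ^ (1 - β) with hA
  have hA0 : 0 < A := by positivity
  have hs2 : s ^ 2 ≤ 8 * C * (L ^ 2 * lam ^ θ) + 16 * C * (L * A * lam ^ (-θ)) := by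
    have h1 : 4 * L / H * T ≤ 4 * C * (L ^ 2 * ((H : ℝ) * lam) ^ α)
        + 8 * C * (L * A) * (lam ^ (-α) * (H : ℝ) ^ (1 - α) / H) := by
      calc 4 * L / H * T ≤ 4 * L / H * (C * ((H : ℝ) * (L * ((H : ℝ) * lam) ^ α))
              + C * (A * lam ^ (-α)) * (2 * (H : ℝ) ^ (1 - α))) := by
            apply mul_le_mul_of_nonneg_left hTb; positivity
        _ = 4 * C * (L ^ 2 * ((H : ℝ) * lam) ^ α)
              + 8 * C * (L * A) * (lam ^ (-α) * (H : ℝ) ^ (1 - α) / H) := by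
            field_simp
            ring
    have h2 : 2 * L ^ 2 / H ≤ 4 * (L ^ 2 * lam ^ θ) := by
      have : 2 * L ^ 2 / H = 2 * L ^ 2 * (1 / H) := by ring
      rw [this]; nlinarith [ha, sq_nonneg L]
    have h3 : 4 * C * (L ^ 2 * ((H : ℝ) * lam) ^ α) ≤ 4 * C * (L ^ 2 * lam ^ θ) := by
      apply mul_le_mul_of_nonneg_left _ (by positivity)
      exact mul_le_mul_of_nonneg_left hb (by positivity)
    have h4 : 8 * C * (L * A) * (lam ^ (-α) * (H : ℝ) ^ (1 - α) / H)
        ≤ 8 * C * (L * A) * (2 * lam ^ (-θ)) :=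
      mul_le_mul_of_nonneg_left hc (by positivity)
    have h5 : 4 * (L ^ 2 * lam ^ θ) ≤ 4 * C * (L ^ 2 * lam ^ θ) := by
      have : 0 ≤ L ^ 2 * lam ^ θ := by positivity
      nlinarith
    nlinarith [hvdc, h1, h2, h3, h4, h5]
  -- `X = L lam^{θ/2}`, `Y = L^{1-β/2} lam^{-θ/2}`
  set X : ℝ := L * lam ^ (θ / 2) with hX
  set Y : ℝ := L ^ (1 - β / 2) * lam ^ (-(θ / 2)) with hY
  have hX0 : 0 ≤ X := by positivity
  have hY0 : 0 ≤ Y := by positivity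
  have hX2 : X ^ 2 = L ^ 2 * lam ^ θ := by
    rw [hX, mul_pow, ← Real.rpow_natCast (lam ^ (θ / 2)) 2, ← Real.rpow_mul hlam.le]
    norm_num
  have hY2 : Y ^ 2 = L * A * lam ^ (-θ) := by
    rw [hY, hA, mul_pow, ← Real.rpow_natCast (L ^ (1 - β / 2)) 2, ← Real.rpow_mul hL0.le,
      ← Real.rpow_natCast (lam ^ (-(θ / 2))) 2, ← Real.rpow_mul hlam.le]
    have e1 : (1 - β / 2) * ((2 : ℕ) : ℝ) = 1 + (1 - β) := by push_cast; ring
    have e2 : -(θ / 2) * ((2 : ℕ) : ℝ) = -θ := by push_cast; ring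
    rw [e1, e2, Real.rpow_add hL0, Real.rpow_one]
  have hfin : s ^ 2 ≤ (8 * C * (X + Y)) ^ 2 := by
    rw [← hX2, ← hY2] at hs2
    have e : (8 * C * (X + Y)) ^ 2
        = 64 * C ^ 2 * X ^ 2 + 64 * C ^ 2 * Y ^ 2 + 128 * C ^ 2 * (X * Y) := by ring
    have hX2n : 0 ≤ X ^ 2 := sq_nonneg X
    have hY2n : 0 ≤ Y ^ 2 := sq_nonneg Y
    have hc1 : 8 * C ≤ 64 * C ^ 2 := by nlinarith
    have hc2 : 16 * C ≤ 64 * C ^ 2 := by nlinarith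
    have i1 : 8 * C * X ^ 2 ≤ 64 * C ^ 2 * X ^ 2 := mul_le_mul_of_nonneg_right hc1 hX2n
    have i2 : 16 * C * Y ^ 2 ≤ 64 * C ^ 2 * Y ^ 2 := mul_le_mul_of_nonneg_right hc2 hY2n
    have i3 : 0 ≤ 128 * C ^ 2 * (X * Y) := by positivity
    rw [e]; linarith
  have hθ2 : θ / 2 = α / (2 * (1 + α)) := by rw [hθ]; field_simp
  rw [← hθ2]
  exact (abs_le_of_sq_le_sq' hfin (by positivity)).2


set_option maxHeartbeats 800000 in
/-- **Induction step of the `k`-th derivative test with Titchmarsh's exponents** (Weyl–van der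
Corput differencing, Titchmarsh §5.13 / Graham–Kolesnik Thm 2.8): a sharp bound at level `k` with
constants `(C, α, β)`, `α ≤ 1/2`, gives one at level `k + 1` with constants
`(8C, α/(2(1+α)), β/2)`; the gain over `Literature.NumberTheory.LFunctions.VdC.kbound_step` comes from summing
`∑_{d<H} d^{-α} ≤ 2 H^{1-α}` instead of using `d ≥ 1`. [cite: Titchmarsh1986, Thm 5.13] -/
theorem kboundSharp_step {h : ℝ} {k : ℕ} {C α β : ℝ} (hC : 1 ≤ C) (hα : 0 < α)
    (hα1 : α ≤ 1 / 2) (hβ : 0 < β) (hβ1 : β ≤ 1)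
    (HK : ∀ lam : ℝ, 0 < lam → ∀ a b : ℤ, a < b → ∀ D : ℕ → ℝ → ℝ, DerivFamily D a b k →
        (∀ y ∈ Set.Icc (a : ℝ) b, lam ≤ D k y ∧ D k y ≤ h * lam) →
          ‖∑ n ∈ Finset.Ioc a b, e (D 0 n)‖
            ≤ C * (((b : ℝ) - a) * lam ^ (α)
              + ((b : ℝ) - a) ^ (1 - β) * lam ^ (-(α)))) :
    ∀ lam : ℝ, 0 < lam → ∀ a b : ℤ, a < b → ∀ D : ℕ → ℝ → ℝ, DerivFamily D a b (k + 1) →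
      (∀ y ∈ Set.Icc (a : ℝ) b, lam ≤ D (k + 1) y ∧ D (k + 1) y ≤ h * lam) →
        ‖∑ n ∈ Finset.Ioc a b, e (D 0 n)‖
          ≤ (8 * C) * (((b : ℝ) - a) * lam ^ (α / (2 * (1 + α)))
            + ((b : ℝ) - a) ^ (1 - β / 2) * lam ^ (-(α / (2 * (1 + α))))) := by
  intro lam hlam a b hab D hD hbound
  have hab' : (a : ℝ) < b := by exact_mod_cast hab
  set L : ℝ := (b : ℝ) - a with hL
  have hL1 : 1 ≤ L := by
    have : a + 1 ≤ b := hab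
    have : ((a : ℤ) : ℝ) + 1 ≤ b := by exact_mod_cast this
    linarith
  have hL0 : 0 < L := by linarith
  set s := ‖∑ n ∈ Finset.Ioc a b, e (D 0 n)‖ with hs
  have hs0 : 0 ≤ s := norm_nonneg _
  have htriv : s ≤ L := norm_sum_e_Ioc_le hab.le _
  set α' : ℝ := α / (2 * (1 + α)) with hα'
  have hα'0 : 0 < α' := by rw [hα']; positivity
  have h8C : (1 : ℝ) ≤ 8 * C := by linarith
  have hRHS1 : 0 ≤ L * lam ^ α' := by positivity
  have hRHS2 : 0 ≤ L ^ (1 - β / 2) * lam ^ (-α') := by positivity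
  -- Case `lam ≥ 1`
  rcases le_or_gt 1 lam with hlam1 | hlam1
  · have h1 : L ≤ L * lam ^ α' := by
      have : 1 ≤ lam ^ α' := Real.one_le_rpow hlam1 hα'0.le
      nlinarith
    calc s ≤ L := htriv
      _ ≤ 1 * (L * lam ^ α' + L ^ (1 - β / 2) * lam ^ (-α')) := by linarith
      _ ≤ 8 * C * (L * lam ^ α' + L ^ (1 - β / 2) * lam ^ (-α')) :=
          mul_le_mul_of_nonneg_right h8C (by positivity)
  -- Case `lam < 1`
  set θ : ℝ := α / (1 + α) with hθ
  have hθpos : 0 < θ := by rw [hθ]; positivity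
  have hα'θ : α' = θ / 2 := by rw [hα', hθ]; field_simp
  set H₀ : ℝ := lam ^ (-θ) with hH₀
  have hH₀1 : 1 ≤ H₀ := Real.one_le_rpow_of_pos_of_le_one_of_nonpos hlam hlam1.le (by linarith)
  rcases le_or_gt L H₀ with hLH | hLH
  · -- Sub-case `L ≤ H₀`: trivial bound
    have h2 : L ^ (β / 2) ≤ lam ^ (-α') := by
      calc L ^ (β / 2) ≤ H₀ ^ (β / 2) := Real.rpow_le_rpow hL0.le hLH (by positivity)
        _ = lam ^ (-θ * (β / 2)) := by rw [hH₀, ← Real.rpow_mul hlam.le]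
        _ ≤ lam ^ (-α') := by
            apply Real.rpow_le_rpow_of_exponent_ge hlam hlam1.le
            rw [hα'θ]
            nlinarith [hθpos, hβ1]
    have h3 : L = L ^ (1 - β / 2) * L ^ (β / 2) := by
      rw [← Real.rpow_add hL0]; norm_num
    have h4 : L ≤ L ^ (1 - β / 2) * lam ^ (-α') := by
      calc L = L ^ (1 - β / 2) * L ^ (β / 2) := h3
        _ ≤ L ^ (1 - β / 2) * lam ^ (-α') :=
          mul_le_mul_of_nonneg_left h2 (Real.rpow_nonneg hL0.le _)
    calc s ≤ L := htriv
      _ ≤ 1 * (L * lam ^ α' + L ^ (1 - β / 2) * lam ^ (-α')) := by linarith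
      _ ≤ 8 * C * (L * lam ^ α' + L ^ (1 - β / 2) * lam ^ (-α')) :=
          mul_le_mul_of_nonneg_right h8C (by positivity)
  · -- Sub-case `H₀ < L`: differencing
    set H : ℕ := ⌊H₀⌋₊ with hHdef
    have hH1 : 1 ≤ H := (Nat.one_le_floor_iff _).2 hH₀1
    have hHpos : (0 : ℝ) < H := by exact_mod_cast hH1
    have hHH₀ : (H : ℝ) ≤ H₀ := Nat.floor_le (by linarith)
    have hH₀H : H₀ < 2 * H := by
      have := Nat.lt_floor_add_one H₀
      have : (1 : ℝ) ≤ H := by exact_mod_cast hH1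
      linarith
    have hHL : (H : ℤ) ≤ b - a := by
      have : (H : ℝ) < (b : ℝ) - a := lt_of_le_of_lt hHH₀ hLH
      have : ((H : ℤ) : ℝ) < ((b - a : ℤ) : ℝ) := by push_cast; exact_mod_cast this
      exact (Int.cast_lt.1 this).le
    have hvdc := vanDerCorput_e (D 0) hH1 hHL
    -- bound for each differenced sum
    have hSd : ∀ d ∈ Finset.Ico (1 : ℤ) H,
        ‖∑ n ∈ Finset.Ioc a (b - d), e (D 0 ((n + d : ℤ)) - D 0 n)‖
          ≤ C * (L * ((H : ℝ) * lam) ^ α)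
            + C * (L ^ (1 - β) * lam ^ (-α)) * ((d : ℤ) : ℝ) ^ (-α) := by
      intro d hd
      rw [Finset.mem_Ico] at hd
      have hd0 : (0 : ℝ) < d := by exact_mod_cast hd.1
      have hd1 : (1 : ℝ) ≤ d := by exact_mod_cast hd.1
      have hdH : (d : ℝ) ≤ H := by
        have : d + 1 ≤ H := hd.2
        have : ((d : ℤ) : ℝ) + 1 ≤ ((H : ℤ) : ℝ) := by exact_mod_cast this
        push_cast at this; linarith
      have habd : a < b - d := by omega
      -- the differenced family
      set Dd : ℕ → ℝ → ℝ := fun j y => D j (y + d) - D j y with hDd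
      have hDd1 : DerivFamily Dd a ((b - d : ℤ) : ℝ) k := by
        have := (hD.mono (Nat.le_succ k)).diff (d := (d : ℝ)) hd0.le
        push_cast
        exact this
      have hDd2 : ∀ y ∈ Set.Icc (a : ℝ) ((b - d : ℤ) : ℝ),
          (d : ℝ) * lam ≤ Dd k y ∧ Dd k y ≤ h * ((d : ℝ) * lam) := by
        intro y hy
        push_cast at hy
        exact hD.diff_bound hd0 hbound y hy
      have hK := HK ((d : ℝ) * lam) (by positivity) a (b - d) habd Dd hDd1 hDd2
      have hsum : ∑ n ∈ Finset.Ioc a (b - d), e (D 0 ((n + d : ℤ)) - D 0 n)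
          = ∑ n ∈ Finset.Ioc a (b - d), e (Dd 0 n) := by
        refine Finset.sum_congr rfl fun n _ => ?_
        simp only [hDd]; push_cast; ring_nf
      rw [hsum]
      refine hK.trans ?_
      have hLd : ((b - d : ℤ) : ℝ) - a = L - d := by push_cast; rw [hL]; ring
      rw [hLd]
      have hLd0 : 0 ≤ L - d := by
        have : ((a : ℤ) : ℝ) < ((b - d : ℤ) : ℝ) := by exact_mod_cast habd
        push_cast at this
        rw [hL]; linarith
      have hLdL : L - d ≤ L := by linarith
      have i1 : (L - d) * ((d : ℝ) * lam) ^ α ≤ L * ((H : ℝ) * lam) ^ α :=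
        mul_le_mul hLdL (Real.rpow_le_rpow (by positivity) (by nlinarith) hα.le)
          (by positivity) hL0.le
      have i2 : (L - d) ^ (1 - β) * ((d : ℝ) * lam) ^ (-α)
          ≤ L ^ (1 - β) * lam ^ (-α) * (d : ℝ) ^ (-α) := by
        rw [Real.mul_rpow hd0.le hlam.le]
        have : (L - d) ^ (1 - β) ≤ L ^ (1 - β) := Real.rpow_le_rpow hLd0 hLdL (by linarith)
        calc (L - d) ^ (1 - β) * ((d : ℝ) ^ (-α) * lam ^ (-α))
            ≤ L ^ (1 - β) * ((d : ℝ) ^ (-α) * lam ^ (-α)) :=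
              mul_le_mul_of_nonneg_right this (by positivity)
          _ = L ^ (1 - β) * lam ^ (-α) * (d : ℝ) ^ (-α) := by ring
      calc C * ((L - d) * ((d : ℝ) * lam) ^ α + (L - d) ^ (1 - β) * ((d : ℝ) * lam) ^ (-α))
          ≤ C * (L * ((H : ℝ) * lam) ^ α + L ^ (1 - β) * lam ^ (-α) * (d : ℝ) ^ (-α)) :=
            mul_le_mul_of_nonneg_left (add_le_add i1 i2) (by linarith)
        _ = C * (L * ((H : ℝ) * lam) ^ α)
            + C * (L ^ (1 - β) * lam ^ (-α)) * ((d : ℤ) : ℝ) ^ (-α) := by ring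
    -- sum over `d`
    have hT : ∑ d ∈ Finset.Ico (1 : ℤ) H,
        ‖∑ n ∈ Finset.Ioc a (b - d), e (D 0 ((n + d : ℤ)) - D 0 n)‖
          ≤ C * ((H : ℝ) * (L * ((H : ℝ) * lam) ^ α))
            + C * (L ^ (1 - β) * lam ^ (-α)) * (2 * (H : ℝ) ^ (1 - α)) := by
      refine (Finset.sum_le_sum hSd).trans ?_
      rw [Finset.sum_add_distrib, Finset.sum_const, nsmul_eq_mul, Int.card_Ico, ← Finset.mul_sum]
      apply add_le_add
      · have hcard : (((H : ℤ) - 1).toNat : ℝ) ≤ H := by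
          have h1 : (((H : ℤ) - 1).toNat : ℤ) = (H : ℤ) - 1 := Int.toNat_of_nonneg (by omega)
          have h2 : ((((H : ℤ) - 1).toNat : ℕ) : ℝ) = (((H : ℤ) - 1 : ℤ) : ℝ) := by
            exact_mod_cast h1
          rw [h2]; push_cast; linarith
        have hx : 0 ≤ C * (L * ((H : ℝ) * lam) ^ α) := by positivity
        calc (((H : ℤ) - 1).toNat : ℝ) * (C * (L * ((H : ℝ) * lam) ^ α))
            ≤ (H : ℝ) * (C * (L * ((H : ℝ) * lam) ^ α)) := mul_le_mul_of_nonneg_right hcard hx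
          _ = C * ((H : ℝ) * (L * ((H : ℝ) * lam) ^ α)) := by ring
      · apply mul_le_mul_of_nonneg_left _ (by positivity)
        refine (sum_Ico_int_rpow_neg_le H hα (by linarith)).trans ?_
        rw [div_le_iff₀ (by linarith : (0 : ℝ) < 1 - α)]
        have : 0 ≤ (H : ℝ) ^ (1 - α) := by positivity
        nlinarith
    exact stepSharp_algebra hC hα (by linarith) hlam hL1 hH₀ hH1 hHH₀ hH₀H hvdc hT


/-- **Third derivative test** (Titchmarsh Thm 5.11 / Graham–Kolesnik Thm 2.6, weak constants): if
`λ ≤ f⁽³⁾ ≤ hλ` on `[a, b]` then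
`‖∑_{a<n≤b} e(f(n))‖ ≤ 96 h ((b-a) λ^{1/6} + (b-a)^{1/2} λ^{-1/6})`.
[cite: Titchmarsh1986, Thm 5.11] -/
theorem thirdDerivTest {h : ℝ} (hh : 1 ≤ h) :
    ∀ lam : ℝ, 0 < lam → ∀ a b : ℤ, a < b → ∀ D : ℕ → ℝ → ℝ, DerivFamily D a b 3 →
      (∀ y ∈ Set.Icc (a : ℝ) b, lam ≤ D 3 y ∧ D 3 y ≤ h * lam) →
        ‖∑ n ∈ Finset.Ioc a b, e (D 0 n)‖
          ≤ (96 * h) * (((b : ℝ) - a) * lam ^ (1 / 6 : ℝ)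
            + ((b : ℝ) - a) ^ (1 - 1 / 2 : ℝ) * lam ^ (-(1 / 6 : ℝ))) := by
  intro lam hlam a b hab D hD hbound
  have h12 : (1 : ℝ) ≤ 12 * h := by linarith
  have := kboundSharp_step (k := 2) h12 (by norm_num : (0 : ℝ) < 1 / 2) le_rfl (by norm_num) le_rfl
    (kboundSharp_two hh) lam hlam a b hab D hD hbound
  have e1 : (1 : ℝ) / 2 / (2 * (1 + 1 / 2)) = 1 / 6 := by norm_num
  have e2 : (8 : ℝ) * (12 * h) = 96 * h := by ring
  rw [e1, e2] at this
  exact this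

/-- **Fourth derivative test** (Titchmarsh Thm 5.13 with `k = 4`, weak constants): if
`λ ≤ f⁽⁴⁾ ≤ hλ` on `[a, b]` then
`‖∑_{a<n≤b} e(f(n))‖ ≤ 768 h ((b-a) λ^{1/14} + (b-a)^{3/4} λ^{-1/14})`; this is the estimate
behind the exponent pair `(1/14, 11/14) = A²B(0, 1)`. [cite: Titchmarsh1986, Thm 5.13 (k = 4)] -/
theorem fourthDerivTest {h : ℝ} (hh : 1 ≤ h) :
    ∀ lam : ℝ, 0 < lam → ∀ a b : ℤ, a < b → ∀ D : ℕ → ℝ → ℝ, DerivFamily D a b 4 →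
      (∀ y ∈ Set.Icc (a : ℝ) b, lam ≤ D 4 y ∧ D 4 y ≤ h * lam) →
        ‖∑ n ∈ Finset.Ioc a b, e (D 0 n)‖
          ≤ (768 * h) * (((b : ℝ) - a) * lam ^ (1 / 14 : ℝ)
            + ((b : ℝ) - a) ^ (1 - 1 / 4 : ℝ) * lam ^ (-(1 / 14 : ℝ))) := by
  intro lam hlam a b hab D hD hbound
  have h96 : (1 : ℝ) ≤ 96 * h := by linarith
  have := kboundSharp_step (k := 3) h96 (by norm_num : (0 : ℝ) < 1 / 6) (by norm_num)
    (by norm_num : (0 : ℝ) < 1 / 2) (by norm_num) (thirdDerivTest hh) lam hlam a b hab D hD hbound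
  have e1 : (1 : ℝ) / 6 / (2 * (1 + 1 / 6)) = 1 / 14 := by norm_num
  have e2 : (8 : ℝ) * (96 * h) = 768 * h := by ring
  have e3 : (1 : ℝ) - 1 / 2 / 2 = 1 - 1 / 4 := by norm_num
  rw [e1, e2, e3] at this
  exact this

/-- Sign wrapper for the fourth derivative test: the same bound when `λ ≤ ε f⁽⁴⁾ ≤ hλ` with
`ε = ±1` (conjugate the sum). [folklore] -/
theorem fourthDerivTest_signed {h : ℝ} (hh : 1 ≤ h) {ε : ℝ} (hε : ε = 1 ∨ ε = -1) {lam : ℝ}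
    (hlam : 0 < lam) {a b : ℤ} (hab : a < b) {D : ℕ → ℝ → ℝ} (hD : DerivFamily D a b 4)
    (hbound : ∀ y ∈ Set.Icc (a : ℝ) b, lam ≤ ε * D 4 y ∧ ε * D 4 y ≤ h * lam) :
    ‖∑ n ∈ Finset.Ioc a b, e (D 0 n)‖
      ≤ (768 * h) * (((b : ℝ) - a) * lam ^ (1 / 14 : ℝ)
        + ((b : ℝ) - a) ^ (3 / 4 : ℝ) * lam ^ (-(1 / 14 : ℝ))) := by
  set D' : ℕ → ℝ → ℝ := fun j y => ε * D j y with hD'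
  have hD'fam : DerivFamily D' a b 4 := fun j hj y hy => (hD j hj y hy).const_mul ε
  have hK := fourthDerivTest hh lam hlam a b hab D' hD'fam hbound
  have hnorm : ‖∑ n ∈ Finset.Ioc a b, e (D 0 n)‖ = ‖∑ n ∈ Finset.Ioc a b, e (D' 0 n)‖ := by
    rcases hε with h1 | h1
    · simp [hD', h1]
    · have : ∑ n ∈ Finset.Ioc a b, e (D' 0 n)
          = (starRingEnd ℂ) (∑ n ∈ Finset.Ioc a b, e (D 0 n)) := by
        rw [map_sum]
        refine Finset.sum_congr rfl fun n _ => ?_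
        simp only [hD', h1, neg_mul, one_mul]
        exact e_neg _
      rw [this, Complex.norm_conj]
  rw [hnorm]
  have e3 : (1 : ℝ) - 1 / 4 = 3 / 4 := by norm_num
  rw [e3] at hK
  exact hK


/-! ## Application: dyadic zeta sums `∑_{M/2 ≤ m ≤ M} m^{it}` -/

/-- `∑_{j < m ≤ f} m^{it} = ∑_{j < n ≤ f} e(D₀(n))` for the phase family `D = phaseD (-t)`,
`D₀(y) = (t/2π) log y`. [folklore] -/
theorem sum_Icc_cpow_mul_I_eq_sum_e_phaseD (t : ℝ) (j f : ℕ) :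
    ∑ m ∈ Finset.Icc (j + 1) f, (m : ℂ) ^ ((t : ℂ) * Complex.I)
      = ∑ n ∈ Finset.Ioc (j : ℤ) (f : ℤ), e (phaseD (-t) 0 n) := by
  rw [sum_Ioc_int_eq_nat, Finset.Icc_add_one_left_eq_Ioc]
  refine Finset.sum_congr rfl fun n hn => ?_
  have hn0 : 0 < n := by
    have := (Finset.mem_Ioc.1 hn).1
    omega
  push_cast
  rw [e_phaseD_zero (-t) hn0]
  congr 1
  push_cast
  ring

/-- The fourth derivative of the phase family `phaseD (-t)`: `-D₄(y) = (3t/π) / y⁴`. [folklore] -/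
theorem neg_phaseD_neg_four (t y : ℝ) : (-1) * phaseD (-t) 4 y = 3 * t / π / y ^ 4 := by
  have h : phaseD (-t) 4 y
      = -t / (2 * π) * (-1) ^ (3 + 1) * (Nat.factorial 3 : ℝ) * y ^ (-((3 : ℤ) + 1)) :=
    phaseD_succ (-t) 3 y
  have h6 : (Nat.factorial 3 : ℝ) = 6 := by norm_num [Nat.factorial]
  have hz : y ^ (-((3 : ℤ) + 1)) = (y ^ 4)⁻¹ := by
    rw [show (-((3 : ℤ) + 1)) = -((4 : ℕ) : ℤ) by norm_num, zpow_neg, zpow_natCast]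
  rw [h, h6, hz]
  field_simp
  ring

/-- **Fourth-derivative bound for dyadic zeta sums**: there is an absolute constant `C` with
`‖∑_{M/2 ≤ m ≤ M} m^{it}‖ ≤ C (M^{5/7} t^{1/14} + M^{29/28} t^{-1/14})` for all real `t ≥ 1`,
`M ≥ 1`. This is the van der Corput estimate belonging to the exponent pair
`(1/14, 11/14) = A²B(0,1)` for `f(y) = (t/2π) log y` on `[M/2, M]`, where `|f⁽⁴⁾| ≍ t/M⁴`: main
term `M (t/M⁴)^{1/14} = M^{5/7} t^{1/14}`, secondary term `M^{3/4} (t/M⁴)^{-1/14}`.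
[cite: Titchmarsh1986, Thm 5.13 (k = 4), §5.20] -/
theorem norm_sum_Icc_cpow_mul_I_le :
    ∃ C : ℝ, 0 ≤ C ∧ ∀ t : ℝ, 1 ≤ t → ∀ M : ℝ, 1 ≤ M →
      ‖∑ m ∈ Finset.Icc ⌈M / 2⌉₊ ⌊M⌋₊, (m : ℂ) ^ ((t : ℂ) * Complex.I)‖
        ≤ C * (M ^ (5 / 7 : ℝ) * t ^ (1 / 14 : ℝ) + M ^ (29 / 28 : ℝ) * t ^ (-(1 / 14 : ℝ))) := by
  refine ⟨2 * (768 * 256), by norm_num, ?_⟩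
  intro t ht M hM
  have hM0 : 0 < M := by linarith
  have ht0 : 0 < t := by linarith
  have hmain1 : 1 ≤ M ^ (5 / 7 : ℝ) * t ^ (1 / 14 : ℝ) :=
    one_le_mul_of_one_le_of_one_le (Real.one_le_rpow hM (by norm_num))
      (Real.one_le_rpow ht (by norm_num))
  have hsec0 : 0 ≤ M ^ (29 / 28 : ℝ) * t ^ (-(1 / 14 : ℝ)) := by positivity
  set c : ℕ := ⌈M / 2⌉₊ with hc
  set f : ℕ := ⌊M⌋₊ with hf
  have hcM : M / 2 ≤ c := Nat.le_ceil _
  have hcM' : (c : ℝ) < M / 2 + 1 := Nat.ceil_lt_add_one (by positivity)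
  have hfM : (f : ℝ) ≤ M := Nat.floor_le hM0.le
  have hfM' : M - 1 < f := by
    have := Nat.lt_floor_add_one M
    linarith
  by_cases hM8 : M < 8
  · -- small `M`: trivial bound
    have hcard : ‖∑ m ∈ Finset.Icc c f, (m : ℂ) ^ ((t : ℂ) * Complex.I)‖ ≤ 5 := by
      refine (norm_sum_le _ _).trans ?_
      have h1 : ∀ m ∈ Finset.Icc c f, ‖(m : ℂ) ^ ((t : ℂ) * Complex.I)‖ ≤ 1 := by
        intro m hm
        have hc1 : 1 ≤ c := Nat.one_le_iff_ne_zero.2 (Nat.ceil_pos.2 (by positivity)).ne'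
        have hm0 : 0 < m := lt_of_lt_of_le hc1 (Finset.mem_Icc.1 hm).1
        rw [Complex.norm_natCast_cpow_of_pos hm0]
        simp
      refine (Finset.sum_le_sum h1).trans ?_
      rw [Finset.sum_const, nsmul_eq_mul, mul_one, Nat.card_Icc]
      rcases le_or_gt c (f + 1) with h | h
      · rw [Nat.cast_sub h]
        push_cast
        linarith
      · rw [Nat.sub_eq_zero_of_le h.le]
        norm_num
    calc ‖∑ m ∈ Finset.Icc c f, (m : ℂ) ^ ((t : ℂ) * Complex.I)‖ ≤ 5 := hcard
      _ ≤ 5 * (M ^ (5 / 7 : ℝ) * t ^ (1 / 14 : ℝ)) := by nlinarith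
      _ ≤ 2 * (768 * 256)
          * (M ^ (5 / 7 : ℝ) * t ^ (1 / 14 : ℝ) + M ^ (29 / 28 : ℝ) * t ^ (-(1 / 14 : ℝ))) := by
          nlinarith
  · -- `M ≥ 8`: fourth derivative test on `(j, f]`, `j = ⌈M/2⌉ - 1`
    rw [not_lt] at hM8
    obtain ⟨j, hj⟩ : ∃ j : ℕ, c = j + 1 :=
      ⟨c - 1, by have := Nat.ceil_pos.2 (show 0 < M / 2 by positivity); omega⟩
    have hcj : (c : ℝ) = j + 1 := by rw [hj]; push_cast; ring
    have hjM : M / 2 - 1 ≤ j := by linarith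
    have hjM' : (j : ℝ) < M / 2 := by linarith
    have hj4 : M / 4 ≤ j := by linarith
    have hj0 : (0 : ℝ) < j := by linarith
    have hjf : (j : ℤ) < f := by
      have : (j : ℝ) < f := by linarith
      exact_mod_cast this
    set L : ℝ := ((f : ℤ) : ℝ) - ((j : ℤ) : ℝ) with hLdef
    have hL : L ≤ M := by rw [hLdef]; push_cast; linarith
    have hL0 : 0 < L := by rw [hLdef]; push_cast; linarith
    rw [hj, sum_Icc_cpow_mul_I_eq_sum_e_phaseD t j f]
    -- the size parameter `λ = (3t/π) / M⁴` of the fourth derivative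
    set K : ℝ := 3 * t / π with hK
    have hπ : 0 < π := Real.pi_pos
    have hK0 : 0 < K := by positivity
    have hKt : K ≤ t := by
      rw [hK, div_le_iff₀ hπ]
      nlinarith [Real.pi_gt_three]
    have htK : t / 2 ≤ K := by
      rw [hK, div_le_div_iff₀ (by norm_num) hπ]
      nlinarith [Real.pi_lt_four]
    set lam : ℝ := K / M ^ 4 with hlam
    have hlam0 : 0 < lam := by positivity
    have hfam : DerivFamily (phaseD (-t)) ((j : ℤ) : ℝ) ((f : ℤ) : ℝ) 4 :=
      phaseD_derivFamily (-t) (by push_cast; exact hj0) 4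
    have hbound : ∀ y ∈ Set.Icc ((j : ℤ) : ℝ) ((f : ℤ) : ℝ),
        lam ≤ (-1) * phaseD (-t) 4 y ∧ (-1) * phaseD (-t) 4 y ≤ 256 * lam := by
      intro y hy
      push_cast at hy
      have hy0 : 0 < y := by linarith [hy.1]
      have hyM : y ≤ M := by linarith [hy.2]
      have hyM' : M / 4 ≤ y := by linarith [hy.1]
      rw [neg_phaseD_neg_four t y]
      constructor
      · exact div_le_div_of_nonneg_left hK0.le (by positivity) (pow_le_pow_left₀ hy0.le hyM 4)
      · calc K / y ^ 4 ≤ K / (M / 4) ^ 4 :=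
            div_le_div_of_nonneg_left hK0.le (by positivity) (pow_le_pow_left₀ (by positivity) hyM' 4)
          _ = 256 * lam := by
            rw [hlam]
            field_simp
            ring
    have hKb := fourthDerivTest_signed (h := 256) (by norm_num) (Or.inr rfl) hlam0 hjf hfam hbound
    -- bookkeeping
    have e1 : lam ^ (1 / 14 : ℝ) = K ^ (1 / 14 : ℝ) * M ^ (-(2 / 7) : ℝ) := by
      rw [hlam, Real.div_rpow hK0.le (by positivity), div_eq_mul_inv,
        ← Real.rpow_neg (by positivity), ← Real.rpow_natCast M 4, ← Real.rpow_mul hM0.le]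
      norm_num
    have e2 : lam ^ (-(1 / 14) : ℝ) = K ^ (-(1 / 14) : ℝ) * M ^ (2 / 7 : ℝ) := by
      rw [hlam, Real.div_rpow hK0.le (by positivity), div_eq_mul_inv,
        ← Real.rpow_neg (by positivity), ← Real.rpow_natCast M 4, ← Real.rpow_mul hM0.le]
      norm_num
    have hK1 : K ^ (1 / 14 : ℝ) ≤ t ^ (1 / 14 : ℝ) := Real.rpow_le_rpow hK0.le hKt (by norm_num)
    have h2le : (2 : ℝ) ^ (1 / 14 : ℝ) ≤ 2 := by
      calc (2 : ℝ) ^ (1 / 14 : ℝ) ≤ (2 : ℝ) ^ (1 : ℝ) :=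
            Real.rpow_le_rpow_of_exponent_le (by norm_num) (by norm_num)
        _ = 2 := Real.rpow_one 2
    have hK2 : K ^ (-(1 / 14) : ℝ) ≤ 2 * t ^ (-(1 / 14) : ℝ) := by
      calc K ^ (-(1 / 14) : ℝ) ≤ (t / 2) ^ (-(1 / 14) : ℝ) :=
            Real.rpow_le_rpow_of_nonpos (by positivity) htK (by norm_num)
        _ = t ^ (-(1 / 14) : ℝ) * (2 : ℝ) ^ (1 / 14 : ℝ) := by
            rw [Real.div_rpow ht0.le (by norm_num), Real.rpow_neg (by norm_num : (0 : ℝ) ≤ 2),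
              div_inv_eq_mul]
        _ ≤ t ^ (-(1 / 14) : ℝ) * 2 := mul_le_mul_of_nonneg_left h2le (by positivity)
        _ = 2 * t ^ (-(1 / 14) : ℝ) := by ring
    have hI : L * lam ^ (1 / 14 : ℝ) ≤ M ^ (5 / 7 : ℝ) * t ^ (1 / 14 : ℝ) := by
      rw [e1]
      calc L * (K ^ (1 / 14 : ℝ) * M ^ (-(2 / 7) : ℝ))
          ≤ M * (t ^ (1 / 14 : ℝ) * M ^ (-(2 / 7) : ℝ)) :=
            mul_le_mul hL (mul_le_mul_of_nonneg_right hK1 (by positivity)) (by positivity) hM0.le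
        _ = M ^ (5 / 7 : ℝ) * t ^ (1 / 14 : ℝ) := by
            have : M ^ (5 / 7 : ℝ) = M * M ^ (-(2 / 7) : ℝ) := by
              rw [show (5 / 7 : ℝ) = 1 + -(2 / 7) by norm_num, Real.rpow_add hM0, Real.rpow_one]
            rw [this]
            ring
    have hII : L ^ (3 / 4 : ℝ) * lam ^ (-(1 / 14 : ℝ))
        ≤ 2 * (M ^ (29 / 28 : ℝ) * t ^ (-(1 / 14 : ℝ))) := by
      rw [show (-(1 / 14 : ℝ)) = (-(1 / 14) : ℝ) by norm_num, e2]
      have hL34 : L ^ (3 / 4 : ℝ) ≤ M ^ (3 / 4 : ℝ) := Real.rpow_le_rpow hL0.le hL (by norm_num)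
      calc L ^ (3 / 4 : ℝ) * (K ^ (-(1 / 14) : ℝ) * M ^ (2 / 7 : ℝ))
          ≤ M ^ (3 / 4 : ℝ) * ((2 * t ^ (-(1 / 14) : ℝ)) * M ^ (2 / 7 : ℝ)) :=
            mul_le_mul hL34 (mul_le_mul_of_nonneg_right hK2 (by positivity)) (by positivity)
              (by positivity)
        _ = 2 * (M ^ (29 / 28 : ℝ) * t ^ (-(1 / 14) : ℝ)) := by
            have : M ^ (29 / 28 : ℝ) = M ^ (3 / 4 : ℝ) * M ^ (2 / 7 : ℝ) := by
              rw [← Real.rpow_add hM0]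
              norm_num
            rw [this]
            ring
    refine hKb.trans ?_
    have h768 : (0 : ℝ) ≤ 768 * 256 := by norm_num
    calc 768 * 256 * (L * lam ^ (1 / 14 : ℝ) + L ^ (3 / 4 : ℝ) * lam ^ (-(1 / 14 : ℝ)))
        ≤ 768 * 256 * (M ^ (5 / 7 : ℝ) * t ^ (1 / 14 : ℝ)
            + 2 * (M ^ (29 / 28 : ℝ) * t ^ (-(1 / 14 : ℝ)))) :=
          mul_le_mul_of_nonneg_left (add_le_add hI hII) h768
      _ ≤ 2 * (768 * 256)
          * (M ^ (5 / 7 : ℝ) * t ^ (1 / 14 : ℝ) + M ^ (29 / 28 : ℝ) * t ^ (-(1 / 14 : ℝ))) := by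
          nlinarith [hmain1, hsec0]

end VdC
end Literature.NumberTheory.LFunctions
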